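import Summits.BirchSwinnertonDyer.BirchSwinnertonDyer.Theorems.ClassRecordThreeCartanSupplyHeckeFamily
import Summits.BirchSwinnertonDyer.BirchSwinnertonDyer.Theorems.ClassRecordThreeCartanSupplyOneSidedTypeCut
import Summits.BirchSwinnertonDyer.BirchSwinnertonDyer.Theorems.ClassRecordThreeCartanSupplyCubicCharacterTables
import Summits.BirchSwinnertonDyer.BirchSwinnertonDyer.Theorems.ClassRecordThreeCartanNaturalRouteClosers
import Summits.BirchSwinnertonDyer.BirchSwinnertonDyer.Theorems.ClassRecordThreeEulerHalvesAtThreeCartanCarayolCuspLift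
import Summits.BirchSwinnertonDyer.BirchSwinnertonDyer.Theorems.ClassRecordThreeEulerHalvesAtThreeCartanCoverPrintClausesDescent
import Summits.BirchSwinnertonDyer.BirchSwinnertonDyer.Theorems.ClassRecordThreeCartanSplitLevelMultiplicityOneOfPure
import Summits.BirchSwinnertonDyer.BirchSwinnertonDyer.Theorems.ClassRecordThreeCartanCuspRow
import Summits.BirchSwinnertonDyer.BirchSwinnertonDyer.Theorems.ClassRecordThreeCartanRealForm
import Summits.BirchSwinnertonDyer.BirchSwinnertonDyer.Theorems.ClassRecordThreeEulerHalvesAtThreeCartanSupplyMonomialPS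
import Literature.NumberTheory.EllipticCurves.NewformGaloisRepArtinConductor
import Literature.NumberTheory.EllipticCurves.SemistabilityDefect
import Literature.RepresentationTheory.FiniteGroups.GL2ModularPrincipalSeriesLatticeReduction
import Literature.RepresentationTheory.FiniteGroups.GL2ModularPrincipalSeriesInvariants
import Mathlib.RingTheory.SimpleModule.Isotypic
import HarnessLib

/-!
# Sketch (stub-ideation k = 1, unit `sidea-stub_jacquetVectorResidual-1-g0`): helper signatures for `STUB-IDEAS-stub_jacquetVectorResidual-1.md`

Scratch file, NOT a skeleton, NOT registered. It elaborates the helper `def … : Prop` signatures of plans P1–P3 and states the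
tree-provable tails as `theorem … := by sorry`. The stub `Jacquet.stub_jacquetVectorResidual : JacquetVectorResidual` is FIXED and is
NOT re-typed: `JV7Copy` below is a byte-identical copy of the BODY of `Jacquet.JacquetVectorResidual` (`Lines/jacquet.lean` l.1327–1334;
a `Lines/` file cannot be imported into a scratch file), used only so that the tails `… → JV7Copy` elaborate; the LEAD states the tails
against the real decl. HONEST: nothing here proves any stub ∕ crux ∕ summit statement; counts 1∕12 · 0∕12 unmoved; BSD is proved for no curve.
-/

set_option linter.dupNamespace false
set_option autoImplicit false

noncomputable section

open scoped Classical MatrixGroups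
open Matrix

namespace Summit.BirchSwinnertonDyer.BirchSwinnertonDyer.Cruxes.CartanOnePlaceDegreeLawAtThree.Jacquet.SideaK1

open Summit.BirchSwinnertonDyer.BirchSwinnertonDyer.Theorems
open Summit.BirchSwinnertonDyer.BirchSwinnertonDyer.Theorems.CartanDegree (HasRatEigenvalue IsScalarMat)
open Summit.BirchSwinnertonDyer.BirchSwinnertonDyer.Theorems.CartanTorusCubeCut (torusSubgroup mem_torusSubgroup G Mat)
open Summit.BirchSwinnertonDyer.BirchSwinnertonDyer.Theorems.CartanCover.Charext.InertHecke (upperUnip lowerUnip coe_upperUnip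
  coe_lowerUnip upperUnip_mul upperUnip_zero)
open scoped Pointwise ModularForm NumberField
open Module UpperHalfPlane
open Literature.NumberTheory.Automorphic WeierstrassCurve Literature.NumberTheory.EllipticCurves Literature.NumberTheory.EllipticCurves.ModularForms
open Literature.NumberTheory.EllipticCurves.Rank1Residual Summit.BirchSwinnertonDyer.Rank1Residual Literature.NumberTheory.GaloisRepresentations NumberField IsDedekindDomain
open Summit.BirchSwinnertonDyer.BirchSwinnertonDyer.Theorems.CartanCover
open Summit.BirchSwinnertonDyer.BirchSwinnertonDyer.Theorems.CartanTorusCubeCut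
open Summit.BirchSwinnertonDyer.BirchSwinnertonDyer.Theorems.CartanDegree (cubicNewvectorChar)
open Summit.BirchSwinnertonDyer.BirchSwinnertonDyer.Theorems.CartanDoubleCoset

/-- Byte-identical copy of the BODY of `Jacquet.JacquetVectorResidual` (the stub's statement, (JV₇)); for elaboration of the tails only. -/
def JV7Copy : Prop :=
  ∀ (V : WeierstrassCurve ℚ) [V.IsElliptic] [V.IsGloballyMinimal], Surj V 3 →
    ∀ (N D M : ℕ) (C : Finset ℕ) (q : ℕ) [Fact q.Prime]
      (X : CartanLevelCurveData D M C) (W₁ : WeierstrassCurve ℚ) [W₁.IsElliptic] (Q : CartanParametrizationData X W₁)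
      (hq : q ∈ C) (R : CoverReduction X q),
      V.conductorNorm ℤ = N → D * M * ∏ p ∈ C, p ^ 2 = N → q ≠ 3 → ¬ q ^ 3 ∣ N →
      3 ∣ (V.baseChange ℚ_[q]).localTamagawaNumber ℤ_[q] → Q.IsMinimalFor V → q % 3 = 1 → q % 4 = 3 →
      ∃ x ∈ R.spanG (R.dockNonsplit hq Q.form), x ≠ 0 ∧ ∀ y : ZMod q, R.indRep (upperUnip y) x = x

/-! ## P1 — ISOTYPIC PRINCIPAL-SERIES CHARACTER (import), Jacquet vector by unipotent averaging (tail) -/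

/-- **H1 (PRINT; the import of P1).** Under NUM's binders at `q ≡ 1 (3)` the `G = GL₂(𝔽_q)`-module `W = ℂ[G]·u_C`
(`u_C = R.dockNonsplit hq Q.form`; `ρ` = the restriction of `indRep`, typed exactly as in (IRR)♮ — it EXISTS by `spanRep`∕`spanRep_apply`) has character `m · χ_PS` for some `m ≥ 1`, where
`χ_PS = cubicNewvectorChar q` is the character of `Ind_B^G(χ₃(a/d))` (tree: `CartanSupply.Monomial.psChar_eq`).
In print: Carayol (A) at `q` (`3 ∣ c_q ⟹ e = 3`, `q ≡ 1 (3)` ⟹ `π_{V,q} = PS(χ₁, χ₂)`, `χᵢ|_{ℤ_q^×} = ε₃^{±1}`) + `π_q^{K(q)} ≅ Ind_{B(𝔽_q)}^{G}(χ̄₁ ⊠ χ̄₂)`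
+ Jacquet–Langlands∕strong approximation onto the principal-level-`q` cover + `u_C` is `V`-isotypic (Hecke family (HF♭)). -/
def DockedSpanPSCharacter : Prop :=
  ∀ (V : WeierstrassCurve ℚ) [V.IsElliptic] [V.IsGloballyMinimal], Surj V 3 →
    ∀ (N D M : ℕ) (C : Finset ℕ) (q : ℕ) [Fact q.Prime]
      (X : CartanLevelCurveData D M C) (W₁ : WeierstrassCurve ℚ) [W₁.IsElliptic] (Q : CartanParametrizationData X W₁)
      (hq : q ∈ C) (R : CoverReduction X q),
      V.conductorNorm ℤ = N → D * M * ∏ p ∈ C, p ^ 2 = N → q ≠ 3 → ¬ q ^ 3 ∣ N →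
      3 ∣ (V.baseChange ℚ_[q]).localTamagawaNumber ℤ_[q] → Q.IsMinimalFor V → q % 3 = 1 →
      ∃ (m : ℕ) (ρ : Representation ℂ (GL (Fin 2) (ZMod q)) (R.spanG (R.dockNonsplit hq Q.form))),
        (∀ (g : GL (Fin 2) (ZMod q)) (F : R.spanG (R.dockNonsplit hq Q.form)),
          ((ρ g F : R.spanG (R.dockNonsplit hq Q.form)) : R.IndCuspForm) = R.indRep g (F : R.IndCuspForm)) ∧
        0 < m ∧ ∀ g : GL (Fin 2) (ZMod q),
          LinearMap.trace ℂ (R.spanG (R.dockNonsplit hq Q.form)) (ρ g) = (m : ℂ) * (cubicNewvectorChar q g : ℂ)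

/-- **T1-core (TREE-PROVABLE, size M; pure finite-group).** If a representation of `GL₂(𝔽_q)` (`q ≡ 1 (3)`) has character `m · χ_PS` with
`m ≥ 1`, it has a non-zero vector fixed by the upper unipotent group `N = {n(y)}`: the averaging operator `P = Σ_y ρ(n(y))` has trace
`m · ((q+1) + (q−1)·1) = 2qm ≠ 0` (`PSChar.char_of_isScalar_ps`, `PSChar.charMat_unipotent`), so `P ≠ 0`, and `P w` is `N`-fixed (`upperUnip_mul`). -/
theorem exists_unip_fixed_of_character_eq_mul_psChar {q : ℕ} [Fact q.Prime] (h1 : q % 3 = 1)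
    {W : Type} [AddCommGroup W] [Module ℂ W] [Module.Finite ℂ W] (ρ : Representation ℂ (GL (Fin 2) (ZMod q)) W)
    {m : ℕ} (hm : 0 < m) (hchar : ∀ g : GL (Fin 2) (ZMod q), LinearMap.trace ℂ W (ρ g) = (m : ℂ) * (cubicNewvectorChar q g : ℂ)) :
    ∃ x : W, x ≠ 0 ∧ ∀ y : ZMod q, ρ (upperUnip y) x = x := by
  sorry

/-- **T1 (TREE-PROVABLE, size S given T1-core): H1 ⟹ (JV₇).** Apply T1-core to the `ρ` of H1 (finite-dimensional by `finite_spanG`),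
read the fixed vector back in `R.IndCuspForm` through the agreement clause. -/
theorem jv7_of_psCharacter (h : DockedSpanPSCharacter) : JV7Copy := by
  sorry


/-! ## P1′ — the CARTAN-COVER TWIN of the in-tree named fact `fullLevelHomology_isIsotypic_tamePrincipalSeries_of_central`
(F1 tree match found this session: `Literature/NumberTheory/EllipticCurves/FullLevelHomologyTamePrincipalSeriesType.lean:114,160` states, for the MODULAR
curve `Y(K(p)K₀(M))`, that the `f_W`-part is isotypic of type the tame principal series `coordRep(ω̃^{p−1−b}, ω̃ᵇ)`; its print chain
(CDT 1999 §5.3 + Lemma 4.2.4 (2) = Casselman's `K(p)`-type + Carayol (A) + Serre–Tate) is exactly P1's, with Eichler–Shimura in place of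
Jacquet–Langlands). H1′ below is that statement read on `W = ℂ[G]·u_C` (a `G`-submodule of the `V`-part), with the type written through
the tree's `GL2.coordRep χ χ⁻¹` for a cubic `χ`; T1′-core is the pure finite-group tail over the tree's PS-invariants API
(`GL2ModularPrincipalSeriesInvariants`: `deltaBorel`, `principalSeriesRep_upperUnip_deltaBorel`, `deltaBorel_ne_zero`, `coordEquiv`). -/

/-- **H1′ (PRINT; recommended typing of P1's import).** Under NUM's binders at `q ≡ 1 (3)`: for some cubic character `χ ≠ 1` of `𝔽_q^×`,
the `ℂ[GL₂(𝔽_q)]`-module `W = ℂ[G]·u_C` (presented, as in the template fact, on an ABSTRACT carrier `V'` with a linear equivalence `e` to the span intertwining `σ` and `indRep` — this avoids the `Submodule.addCommMonoid` ∕ `AddCommGroup` instance-path clash of `ρ.asModule` on a coerced submodule) is ISOTYPIC OF TYPE `coordRep χ χ⁻¹ = Ind_B^G(χ ⊠ χ⁻¹)`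
(Mathlib `IsIsotypicOfType`). Cartan-cover twin of `Literature.NumberTheory.EllipticCurves.fullLevelHomology_isIsotypic_tamePrincipalSeries_of_central`. -/
def DockedSpanIsotypicPS : Prop :=
  ∀ (V : WeierstrassCurve ℚ) [V.IsElliptic] [V.IsGloballyMinimal], Surj V 3 →
    ∀ (N D M : ℕ) (C : Finset ℕ) (q : ℕ) [Fact q.Prime]
      (X : CartanLevelCurveData D M C) (W₁ : WeierstrassCurve ℚ) [W₁.IsElliptic] (Q : CartanParametrizationData X W₁)
      (hq : q ∈ C) (R : CoverReduction X q),
      V.conductorNorm ℤ = N → D * M * ∏ p ∈ C, p ^ 2 = N → q ≠ 3 → ¬ q ^ 3 ∣ N →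
      3 ∣ (V.baseChange ℚ_[q]).localTamagawaNumber ℤ_[q] → Q.IsMinimalFor V → q % 3 = 1 →
      ∃ (χ : (ZMod q)ˣ →* ℂˣ) (V' : Type) (_ : AddCommGroup V') (_ : Module ℂ V') (σ : Representation ℂ (GL (Fin 2) (ZMod q)) V')
        (e : V' ≃ₗ[ℂ] R.spanG (R.dockNonsplit hq Q.form)),
        χ ^ 3 = 1 ∧ χ ≠ 1 ∧
        (∀ (g : GL (Fin 2) (ZMod q)) (v : V'),
          ((e (σ g v) : R.spanG (R.dockNonsplit hq Q.form)) : R.IndCuspForm) = R.indRep g ((e v : R.spanG (R.dockNonsplit hq Q.form)) : R.IndCuspForm)) ∧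
        IsIsotypicOfType (MonoidAlgebra ℂ (GL (Fin 2) (ZMod q))) σ.asModule
          (Literature.RepresentationTheory.FiniteGroups.GL2.coordRep χ χ⁻¹).asModule

/-- **T1′-core (TREE ∕ MATHLIB-PROVABLE, size M; pure finite-group).** A non-zero finite-dimensional `ℂ[GL₂(𝔽_q)]`-module isotypic of type
`Ind_B^G(χ₁ ⊠ χ₂)` has a non-zero `N(𝔽_q)`-fixed vector: it is semisimple (Maschke, `Mathlib/RepresentationTheory/Maschke.lean`), so it has a simple
submodule, which is `≅ coordRep χ₁ χ₂ ≅ principalSeriesRep` (`coordEquiv`), and `deltaBorel χ₁ χ₂ ≠ 0` is `N`-fixed there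
(`principalSeriesRep_upperUnip_deltaBorel`, `deltaBorel_ne_zero`); transport back (the tree's `upperUnip y` and the Literature `GL2.upperUnip (ZMod q) y`
are the same matrix — one `ext` lemma, `coe_upperUnip`). -/
theorem exists_unip_fixed_of_isIsotypicOfType_ps {q : ℕ} [Fact q.Prime]
    {W : Type} [AddCommGroup W] [Module ℂ W] [Module.Finite ℂ W] [Nontrivial W] (ρ : Representation ℂ (GL (Fin 2) (ZMod q)) W)
    (χ₁ χ₂ : (ZMod q)ˣ →* ℂˣ)
    (h : IsIsotypicOfType (MonoidAlgebra ℂ (GL (Fin 2) (ZMod q))) ρ.asModule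
      (Literature.RepresentationTheory.FiniteGroups.GL2.coordRep χ₁ χ₂).asModule) :
    ∃ x : W, x ≠ 0 ∧ ∀ y : ZMod q, ρ (upperUnip y) x = x := by
  sorry

/-- **T1′ (TREE-PROVABLE, size S given T1′-core): H1′ ⟹ (JV₇)** (`W ≠ ⊥` by `dockNonsplit_form_ne_zero`, finite by `finite_spanG`, agreement clause as in §P.3). -/
theorem jv7_of_isotypicPS (h : DockedSpanIsotypicPS) : JV7Copy := by
  sorry

/-! ## P2 — NOT CUSPIDAL BY DIMENSION under (IRR)♮ (import = one number), tail = the §P.3 pattern + the cuspidal row at `g = 1` -/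

/-- **H2 (PRINT; the import of P2 — the weakest-shaped crossing: one dimension).** Under NUM's binders at `q ≡ 7 (12)`:
`dim ℂ[G]·u_C ≠ q − 1`. In print `ℂ[G]·u_C ⊂ (V-isotypic part) ≅ PS^m`, so `dim = k(q+1)` for some `k ≥ 1`, never `q − 1`
(same local–global input as H1, but only its numerical shadow is imported). -/
def DockedSpanRankNotCuspidal : Prop :=
  ∀ (V : WeierstrassCurve ℚ) [V.IsElliptic] [V.IsGloballyMinimal], Surj V 3 →
    ∀ (N D M : ℕ) (C : Finset ℕ) (q : ℕ) [Fact q.Prime]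
      (X : CartanLevelCurveData D M C) (W₁ : WeierstrassCurve ℚ) [W₁.IsElliptic] (Q : CartanParametrizationData X W₁)
      (hq : q ∈ C) (R : CoverReduction X q),
      V.conductorNorm ℤ = N → D * M * ∏ p ∈ C, p ^ 2 = N → q ≠ 3 → ¬ q ^ 3 ∣ N →
      3 ∣ (V.baseChange ℚ_[q]).localTamagawaNumber ℤ_[q] → Q.IsMinimalFor V → q % 3 = 1 → q % 4 = 3 →
      Module.finrank ℂ (R.spanG (R.dockNonsplit hq Q.form)) ≠ q - 1

/-- **T2-core (TREE-PROVABLE, size M; pure finite-group): an irreducible CUSPIDAL `W` with a non-zero `T_η`-fixed vector has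
dimension `q − 1`** — evaluate `exists_character_eq_cuspRow` at `g = 1`: `χ_W(1) = [G : ZN] − [G : T_η] = (q² − 1) − (q² − q)`
(`Representation.char_one`, `card_znSub`, `card_torusSubgroup`, `monRep` on `G ⧸ H → ℂ` so `character 1 = |G ⧸ H|`). -/
theorem finrank_eq_of_irreducible_cuspidal {q : ℕ} [Fact q.Prime] (hq2 : q ≠ 2) (eta : Mat q) (hη : ¬ HasRatEigenvalue eta)
    (W : Type) [AddCommGroup W] [Module ℂ W] [Module.Finite ℂ W] (ρ : Representation ℂ (G q) W)
    (hirr : ∀ W' : Submodule ℂ W, (∀ g : G q, ∀ w ∈ W', ρ g w ∈ W') → W' = ⊥ ∨ W' = ⊤)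
    (hfix : ∃ u : W, u ≠ 0 ∧ ∀ t ∈ torusSubgroup eta, ρ t u = u)
    (hcusp : ∀ w : W, (∀ y : ZMod q, ρ (upperUnip y) w = w) → w = 0) :
    Module.finrank ℂ W = q - 1 := by
  sorry

/-- **T2 (TREE-PROVABLE, size M given T2-core; the §P.3 pattern `jacquetVectorDocked_of_realform` verbatim up to the last line):
(IRR)♮ ∧ H2 ⟹ (JV₇).** By contradiction `W = ℂ[G]·u_C` is cuspidal; by (IRR)♮ it is the irreducible `𝒱` (`eq_spanG_of_irreducible_of_mem`,
`irreducible_subtype`), with `T_η`-fixed `u_C ≠ 0` (`dockNonsplit_form_ne_zero`, `indRep_dockNonsplit_of_mem_torus`); T2-core gives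
`dim = q − 1`, contradicting H2. (IRR)♮ comes from the stub (MO1ᴾ): `coverIsotypicIrreducible_of' (splitFixedRankOne_of_multiplicityOne
(splitLevelMultiplicityOne_of_pure hMP))` — STUB-ORDER CAVEAT for the LEAD (see the ideas file). -/
theorem jv7_of_rank (hIRR : CoverIsotypicIrreducible) (h : DockedSpanRankNotCuspidal) : JV7Copy := by
  sorry

/-! ## P3 — CONDUCTOR DROP OF THE CUBIC TWIST (the local–global crossing by the IN-TREE named fact `Carayol1986_artinConductorExponent`) -/

/-- **H3a-geo (TREE-PROVABLE, size M–L): `3 ∣ c_q` and `q² ∥ N` at `q ≥ 5` force semistability defect `e = 3`** (Tate's algorithm: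
`c_q ∈ {1,3}` only for IV ∕ IV* among additive types — `localTamagawaNumber_*_of_kodairaSymbolAt_*_holds`; `v_q(Δ_min) ∈ {4, 8}` —
`ordMinimalDiscriminant_eq_numComponentsAt_add_one_of_kodairaSymbolAt`; Serre's formula `e = 12 ∕ gcd(12, v_q Δ_min)` —
`semistabilityDefectAt_eq_twelve_div_gcd_of_five_le`; bridge `kodairaSymbolAt_eq_padic`). -/
def SemistabilityDefectThree : Prop :=
  ∀ (V : WeierstrassCurve ℚ) [V.IsElliptic] [V.IsGloballyMinimal] (N q : ℕ) [Fact q.Prime], 5 ≤ q →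
    V.conductorNorm ℤ = N → q ^ 2 ∣ N → ¬ q ^ 3 ∣ N → 3 ∣ (V.baseChange ℚ_[q]).localTamagawaNumber ℤ_[q] →
    V.semistabilityDefectAt q = 3

/-- **H3a (AL₃) — THE CUBIC TWIST DROPS THE LEVEL AT `q` (TREE-PROVABLE from in-tree named facts, size L; instrumented: kit j342858 ∕ j342924,
`d(χ₃) = 1` at every tested pair).** For `q ≡ 1 (3)`, `q ≥ 5`, `q² ∥ N_V`, `3 ∣ c_q`: there is a cubic Dirichlet character `χ` mod `q` and a
newform `g ∈ S₂(Γ₁(N∕q))` with `a_ℓ(g) = χ(ℓ) a_ℓ(V)` for all primes `ℓ ∤ N`. Print chain: H3a-geo (`e = 3`) ⟹ `ρ_V|_{I_q} ⊗ ℚ̄_ℓ ≅ ε₃ ⊕ ε₃⁻¹`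
(tame, `q ≡ 1 (3)` so each summand is `Frob`-stable) ⟹ `a(ρ_V ⊗ χ̃) = 1` for the Teichmüller-type cubic `χ̃` ⟹ the newform `g` of
`f_V ⊗ χ̄` (exists: twisting is Hecke-equivariant off `q`, `CuspFormTwistGamma1.heckeT_twistRaw1`; newform theory on `Γ₁`) has `ρ_g ≅ ρ_V ⊗ χ̃`
(`IsNewformOf.exists_isGaloisRepOfNewform1_rationalTate`, `FramedRep.twist`, Chebotarev + Brauer–Nesbitt) and level exponent
`v_q = a(ρ_g) = 1` by `Carayol1986_artinConductorExponent` (IN TREE: D-0026 debt +0 for the crossing). -/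
def CubicTwistLevelDrop : Prop :=
  ∀ (V : WeierstrassCurve ℚ) [V.IsElliptic] [V.IsGloballyMinimal] (N q : ℕ) [Fact q.Prime], 5 ≤ q → q % 3 = 1 →
    V.conductorNorm ℤ = N → q ^ 2 ∣ N → ¬ q ^ 3 ∣ N → 3 ∣ (V.baseChange ℚ_[q]).localTamagawaNumber ℤ_[q] →
    ∃ χ : DirichletCharacter ℂ q, χ ^ 3 = 1 ∧ χ ≠ 1 ∧
      ∃ (M' : ℕ) (_ : NeZero M') (g : CuspForm (CongruenceSubgroup.Gamma1 M') 2),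
        IsNewform1 g ∧ M' * q = N ∧
        ∀ ℓ : ℕ, ℓ.Prime → ¬ ℓ ∣ N → cuspCoeff g ℓ = χ (ℓ : ZMod q) * ((V.LFunction ℓ : ℤ) : ℂ)

/-- **H3b (PRINT, size XL, D-0026 debt +1: THE DICTIONARY).** (AL₃) ⟹ (JV₇): Jacquet–Langlands (`q ∉ Ram B`, so `π'_{V,q} ≅ π_{V,q} = π_{g,q} ⊗ χ_q`,
`c(π_{g,q}) = 1` ⟹ `π_{V,q}^{K(q)} ≅ Ind_B^G(χ̄ ⊠ χ̄⁻¹·)` has `N(𝔽_q)`-fixed vectors) + strong approximation for the norm-one cover group `ι(O₀'¹)` onto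
`R.IndCuspForm = Ind S₂(Γ̄(q))` + isotypic placement inside `ℂ[G]·u_C` ((HF♭) makes `ℂ[G]·u_C` `V`-isotypic; the `V`-isotypic part is `PS`-isotypic as a
`G`-module, so every non-zero `G`-submodule has `N`-fixed vectors). Stated as the implication itself (its two ends are typed). -/
def CubicTwistEichlerTransfer : Prop := CubicTwistLevelDrop → JV7Copy

/-- **T3 (trivial assembly).** -/
theorem jv7_of_twist (h3a : CubicTwistLevelDrop) (h3b : CubicTwistEichlerTransfer) : JV7Copy := h3b h3a

end Summit.BirchSwinnertonDyer.BirchSwinnertonDyer.Cruxes.CartanOnePlaceDegreeLawAtThree.Jacquet.SideaK1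

end
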